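import Summits.ResolutionOfSingularities.ResolutionOfSingularities.Theorems.PinchTowerFrame

/-!
# PinchTower (P7/8) — THE PINCH TOWER (scheme level): one blow-up step, the Σ-stages, recursion on the weight `a`

Node «PinchTower» of `decomp-res-lens-2` (g31), see `Theorems/MaxContactCutPinchTower.lean`.

The STAGE INVARIANT at weight `a` over `T ⊇ supp 𝓔`: at every `x ∈ T`,
`𝓘_x = (1)` ∨ (`a < n` ∧ `𝓘_x ⊄ 𝔪_xⁿ`) ∨ `𝓘_x` carries a pinch shape `PinchShape 𝓘_x 𝓔_x n a`.
* `PinchShape.blowupInv` — ONE BLOW-UP in a centre `C` whose stalk at `x` is the Σ-pair `(z, u)` of a pinch shape of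
  weight `a ≥ n` propagates the invariant with weight `a - n` to every point over `x` (chart dictionary
  `IsBlowup.exists_reesChart_stalk` + the chart laws `PinchShape.zChart` / `PinchShape.uChart` of P5); it serves the
  curve blow-up (`C = 𝓘(cl{η})`, P8) and the Σ-stages (`C = √(𝓘 + 𝓔)`) alike;
* `pinchStage` — THE ENGINE, by strong recursion on `a`: if `a < n` stop (the exit `τ ≥ 2` at order-`n` points is
  `PinchShape.exit`, P4; the middle alternative contradicts order `n`); if `a ≥ n` blow up `Σ = V(√(𝓘 + 𝓔))` —
  regular of codimension 2 (`(z, u)` is part of an r.s.o.p.), inside `supp(𝓘, n) ∩ T` (`𝓘 ⊆ Q(na) ⊆ 𝔪ⁿ`) —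
  and recurse with `a - n < a`.
[cite: Hironaka1964; CossartJannsenSaito2020; CutkoskyBook2004, §7]
-/

open IsLocalRing
open Literature.AlgebraicGeometry.Resolution
open Summit.ResolutionOfSingularities.ResolutionOfSingularities.Theorems.DeltaFaceCutClasses (qWeighted)
open Summit.ResolutionOfSingularities.ResolutionOfSingularities.Theorems.TowerCut

namespace Summit.ResolutionOfSingularities.ResolutionOfSingularities.Theorems.PinchTower

section Stage

open CategoryTheory AlgebraicGeometry TopologicalSpace Topology
open Summit.ResolutionOfSingularities.ResolutionOfSingularities.Theorems
open Summit.ResolutionOfSingularities.ResolutionOfSingularities.Theorems.WeakOrderReduction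
open Summit.ResolutionOfSingularities.ResolutionOfSingularities.Theorems.RelativeDeltaCut

variable {Z : Scheme.{0}}

/-! ## §S1  One blow-up step in a centre with stalk `(z, u)` -/

/-- **PROPAGATION THROUGH ONE BLOW-UP** (`n ≤ a`): if the centre `C` has stalk `(z, u)` at `x = π x'` for a pinch
shape of `𝓘_x` of weight `a`, then the controlled transform `𝓘' = (𝓘𝒪 : 𝓘_Eⁿ)` at `x'` is `(1)`, or (`a = n` and)
`𝓘'_{x'} ⊄ 𝔪ⁿ`, or carries a pinch shape of weight `a - n` with exceptional stalk `(C𝒪)_{x'}`. [folklore] -/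
theorem PinchShape.blowupInv [IsLocallyNoetherian Z] (hZ : Scheme.IsRegular Z) (C J : Z.IdealSheafData)
    {n a : ℕ} (hn : 1 ≤ n) (hna : n ≤ a) (x' : ↑(blowup C)) {E : Ideal (Z.presheaf.stalk (blowup.π C x'))}
    (D : PinchShape (stalkIdeal J (blowup.π C x')) E n a)
    (hc : Ideal.span (Set.range ![D.z, D.u]) = stalkIdeal C (blowup.π C x')) :
    stalkIdeal (controlledTransform (blowup.π C) C J n) x' = ⊤ ∨
      (a - n < n ∧ ¬ stalkIdeal (controlledTransform (blowup.π C) C J n) x' ≤ maximalIdeal _ ^ n) ∨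
      Nonempty (PinchShape (stalkIdeal (controlledTransform (blowup.π C) C J n) x')
        (stalkIdeal (C.comap (blowup.π C)) x') n (a - n)) := by
  haveI := CentreSeq.isLocallyNoetherian_blowup C
  haveI := hZ (blowup.π C x')
  obtain ⟨j, 𝔴, χ, hχ, hloc, h𝔴⟩ := (blowup.isBlowup C).exists_reesChart_stalk x' ![D.z, D.u] hc
  have hu : ∀ l, ((blowup.π C).stalkMap x').hom (![D.z, D.u] l) =
      ((blowup.π C).stalkMap x').hom (![D.z, D.u] j) * χ (chartGen ![D.z, D.u] j l) :=
    fun l => by rw [← hχ, ← hχ, ← map_mul, ← reesChartBase_apply_eq_mul_chartGen _ j l]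
  have hCmap : (stalkIdeal C (blowup.π C x')).map ((blowup.π C).stalkMap x').hom =
      Ideal.span {((blowup.π C).stalkMap x').hom (![D.z, D.u] j)} := by
    rw [← hc, Ideal.map_span_range_eq_span_singleton _ _ j _ hu]
  have hJ' : stalkIdeal (controlledTransform (blowup.π C) C J n) x' =
      Submodule.colon ((stalkIdeal J (blowup.π C x')).map ((blowup.π C).stalkMap x').hom)
        ((Ideal.span {((blowup.π C).stalkMap x').hom (![D.z, D.u] j)} ^ n : Ideal _) : Set _) := by
    rw [controlledTransform, stalkIdeal_colon, stalkIdeal_pow, stalkIdeal_comap_eq_map_stalkMap,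
      stalkIdeal_comap_eq_map_stalkMap, hCmap]
  have hE' : stalkIdeal (C.comap (blowup.π C)) x' =
      Ideal.span {((blowup.π C).stalkMap x').hom (![D.z, D.u] j)} := by
    rw [stalkIdeal_comap_eq_map_stalkMap, hCmap]
  rw [hJ', hE']
  obtain rfl | rfl : j = 0 ∨ j = 1 := by fin_cases j <;> simp
  · rcases D.zChart hn hna ![D.z, D.u] rfl 𝔴 χ hloc h𝔴 _ hχ with htop | ⟨ha, hnot⟩
    · exact Or.inl htop
    · exact Or.inr (Or.inl ⟨by omega, hnot⟩)
  · rcases D.uChart hn hna ![D.z, D.u] rfl 𝔴 χ hloc h𝔴 _ hχ with (htop | ⟨ha, hnot⟩) | hD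
    · exact Or.inl htop
    · exact Or.inr (Or.inl ⟨by omega, hnot⟩)
    · exact Or.inr (Or.inr hD)

/-! ## §S2  The surface centre `Σ = V(√(𝓘 + 𝓔))` under the stage invariant (`a ≥ n`) -/


/-- **The Σ-stalk at a pinch-shape point**: `√(𝓘 + 𝓔)_x = (z, u)`. [folklore] -/
theorem stalkIdeal_radical_sup_eq' {I Ex : Z.IdealSheafData} {n a : ℕ} {x : Z}
    (D : PinchShape (stalkIdeal I x) (stalkIdeal Ex x) n a) (ha : 1 ≤ a) (hn : 1 ≤ n) :
    stalkIdeal (I ⊔ Ex).radical x = Ideal.span (Set.range ![D.z, D.u]) := by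
  rw [stalkIdeal_radical, stalkIdeal_sup]
  exact D.radical_sup_eq ha hn

/-- **`supp Σ ⊆ supp(𝓘, n)`** under the stage invariant with `n ≤ a` (`𝓘 ⊆ Q(na) ⊆ 𝔪ⁿ` at shape points). [folklore] -/
theorem support_radical_sup_subset' {M : MarkedIdeal Z} {Ex : Z.IdealSheafData} {T : Set Z} {a : ℕ}
    (hTE : (Ex.support : Set Z) ⊆ T) (hna : M.mult ≤ a) (ha : 0 < a)
    (hinv : ∀ x ∈ T, stalkIdeal M.ideal x = ⊤ ∨
      Nonempty (PinchShape (stalkIdeal M.ideal x) (stalkIdeal Ex x) M.mult a)) :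
    (((M.ideal ⊔ Ex).radical).support : Set Z) ⊆ M.support := by
  intro x hx
  obtain ⟨hxE, hJ⟩ := mem_support_radical_sup hx
  rcases hinv x (hTE hxE) with htop | ⟨⟨D⟩⟩
  · exact absurd htop hJ
  · exact (MarkedIdeal.mem_support_iff M x).mpr (D.le_maximalIdeal_pow hna ha)

/-- **The surface centre `Σ = V(√(𝓘 + 𝓔))` is regular** under the stage invariant: its local rings are the quotients
`𝒪_{Z,x}/(z, u)` by part of a regular system of parameters. [folklore] -/
theorem isRegular_radical_sup_subscheme' {M : MarkedIdeal Z} {Ex : Z.IdealSheafData} {T : Set Z} {a : ℕ}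
    (hTE : (Ex.support : Set Z) ⊆ T) (ha : 1 ≤ a) (hn : 1 ≤ M.mult)
    (hinv : ∀ x ∈ T, stalkIdeal M.ideal x = ⊤ ∨
      Nonempty (PinchShape (stalkIdeal M.ideal x) (stalkIdeal Ex x) M.mult a)) :
    Scheme.IsRegular ((M.ideal ⊔ Ex).radical).subscheme := by
  intro s
  have hrange : Set.range ((M.ideal ⊔ Ex).radical).subschemeι.base =
      ((((M.ideal ⊔ Ex).radical).support : Set Z)) := Scheme.IdealSheafData.range_subschemeι _
  have hxS : ((M.ideal ⊔ Ex).radical).subschemeι.base s ∈ ((((M.ideal ⊔ Ex).radical).support : Set Z)) :=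
    hrange ▸ Set.mem_range_self s
  obtain ⟨hxE, hJ⟩ := mem_support_radical_sup hxS
  rcases hinv _ (hTE hxE) with htop | ⟨⟨D⟩⟩
  · exact absurd htop hJ
  · rw [isRegularLocalRing_stalk_subscheme_iff, stalkIdeal_radical_sup_eq' D ha hn]
    exact D.isRegularLocalRing_quotient

/-! ## §S3  THE ENGINE: recursion on the weight `a` -/

/-- **THE PINCH TOWER ENGINE.**  At a stage `(Z, (𝓘, n), 𝓔, T, a)` with the stage invariant over `T ⊇ supp 𝓔`: if
`a < n` nothing is blown up and at every point over `T` of order `n` Hironaka's `τ ≥ 2` (`PinchShape.exit`); if `a ≥ n`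
the surface `Σ = V(√(𝓘 + 𝓔))` (regular, inside `supp(𝓘, n) ∩ T`) is blown up, the invariant holds with `a - n` over
the preimage of `T` (`PinchShape.blowupInv`), and the engine recurses.  The blow-ups form a weakly admissible sequence
with centres over `T`. [folklore] -/
theorem pinchStage (a : ℕ) : ∀ {Z : Scheme.{0}} [IsLocallyNoetherian Z] (hZ : Scheme.IsRegular Z)
    (M : MarkedIdeal Z) (Ex : Z.IdealSheafData) (T : Set Z), 2 ≤ M.mult → (Ex.support : Set Z) ⊆ T →
    (∀ x ∈ T, stalkIdeal M.ideal x = ⊤ ∨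
      (a < M.mult ∧ ¬ stalkIdeal M.ideal x ≤ maximalIdeal _ ^ M.mult) ∨
      Nonempty (PinchShape (stalkIdeal M.ideal x) (stalkIdeal Ex x) M.mult a)) →
    ∃ s : CentreSeq Z, WeakAdmissible s M ∧ s.CentresOver T ∧ ∃ hT : Scheme.IsRegular s.top,
      ∀ x : ↑s.top, s.comp x ∈ T → (M.mult : ℕ∞) ≤ idealOrder (s.transformMarked M).ideal x →
        2 ≤ tauAt hT (s.transformMarked M).ideal M.mult x := by
  induction a using Nat.strong_induction_on with
  | _ a ih =>
  intro Z _ hZ M Ex T hn hTE hinv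
  by_cases han : a < M.mult
  · -- EXIT: no blow-up; `τ ≥ 2` at the order-`n` points over `T`
    refine ⟨CentreSeq.nil Z, trivial, trivial, hZ, fun x hx hord => ?_⟩
    have hxT : x ∈ T := hx
    have hord' : stalkIdeal M.ideal x ≤ maximalIdeal _ ^ M.mult :=
      (le_idealOrder_iff M.ideal x M.mult).mp hord
    haveI := hZ x
    rcases hinv x hxT with htop | ⟨-, hnot⟩ | ⟨⟨D⟩⟩
    · exfalso
      rw [htop, top_le_iff] at hord'
      have h := Ideal.pow_le_self (I := maximalIdeal (Z.presheaf.stalk x)) (n := M.mult) (by omega)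
      rw [hord', top_le_iff] at h
      exact (maximalIdeal.isMaximal _).ne_top h
    · exact absurd hord' hnot
    · obtain ⟨d, c, hd, hc, hτ⟩ := D.exit han hn hord'
      simp only [CentreSeq.transformMarked_nil]
      change 2 ≤ stalkTau M.ideal x M.mult
      rw [stalkTau_eq M.ideal x M.mult hd c hc]
      exact hτ
  · -- BLOW UP `Σ = V(√(𝓘 + 𝓔))` and recurse with `a - n`
    push Not at han
    have hinv' : ∀ x ∈ T, stalkIdeal M.ideal x = ⊤ ∨
        Nonempty (PinchShape (stalkIdeal M.ideal x) (stalkIdeal Ex x) M.mult a) := fun x hx => by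
      rcases hinv x hx with h | ⟨h, -⟩ | h
      · exact Or.inl h
      · exact absurd h (by omega)
      · exact Or.inr h
    haveI := CentreSeq.isLocallyNoetherian_blowup ((M.ideal ⊔ Ex).radical)
    have hSreg : Scheme.IsRegular ((M.ideal ⊔ Ex).radical).subscheme :=
      isRegular_radical_sup_subscheme' hTE (by omega) (by omega) hinv'
    have hZ' : Scheme.IsRegular ↑(blowup ((M.ideal ⊔ Ex).radical)) :=
      IsBlowup.isRegular_of_isRegular_subscheme hZ hSreg (blowup.isBlowup _)
    have hTE' : ((((M.ideal ⊔ Ex).radical).comap (blowup.π ((M.ideal ⊔ Ex).radical))).support : Set _) ⊆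
        blowup.π ((M.ideal ⊔ Ex).radical) ⁻¹' T := fun x' hx' =>
      support_radical_sup_subset_T hTE ((mem_support_comap_iff _ _ x').mp hx')
    have hstep : ∀ x' ∈ blowup.π ((M.ideal ⊔ Ex).radical) ⁻¹' T,
        stalkIdeal (M.transform (blowup.π ((M.ideal ⊔ Ex).radical)) ((M.ideal ⊔ Ex).radical)).ideal x' = ⊤ ∨
        (a - M.mult < (M.transform (blowup.π ((M.ideal ⊔ Ex).radical)) ((M.ideal ⊔ Ex).radical)).mult ∧
          ¬ stalkIdeal (M.transform (blowup.π ((M.ideal ⊔ Ex).radical)) ((M.ideal ⊔ Ex).radical)).ideal x' ≤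
            maximalIdeal _ ^ (M.transform (blowup.π ((M.ideal ⊔ Ex).radical)) ((M.ideal ⊔ Ex).radical)).mult) ∨
        Nonempty (PinchShape
          (stalkIdeal (M.transform (blowup.π ((M.ideal ⊔ Ex).radical)) ((M.ideal ⊔ Ex).radical)).ideal x')
          (stalkIdeal (((M.ideal ⊔ Ex).radical).comap (blowup.π ((M.ideal ⊔ Ex).radical))) x')
          (M.transform (blowup.π ((M.ideal ⊔ Ex).radical)) ((M.ideal ⊔ Ex).radical)).mult (a - M.mult)) := by
      intro x' hx'
      have hxT : blowup.π ((M.ideal ⊔ Ex).radical) x' ∈ T := hx'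
      change stalkIdeal (controlledTransform (blowup.π ((M.ideal ⊔ Ex).radical)) ((M.ideal ⊔ Ex).radical)
          M.ideal M.mult) x' = ⊤ ∨
        (a - M.mult < M.mult ∧ ¬ stalkIdeal (controlledTransform (blowup.π ((M.ideal ⊔ Ex).radical))
          ((M.ideal ⊔ Ex).radical) M.ideal M.mult) x' ≤ maximalIdeal _ ^ M.mult) ∨
        Nonempty (PinchShape (stalkIdeal (controlledTransform (blowup.π ((M.ideal ⊔ Ex).radical))
          ((M.ideal ⊔ Ex).radical) M.ideal M.mult) x')
          (stalkIdeal (((M.ideal ⊔ Ex).radical).comap (blowup.π ((M.ideal ⊔ Ex).radical))) x')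
          M.mult (a - M.mult))
      haveI := hZ (blowup.π ((M.ideal ⊔ Ex).radical) x')
      rcases hinv' _ hxT with htop | ⟨⟨D⟩⟩
      · left
        rw [controlledTransform, stalkIdeal_colon, stalkIdeal_comap_eq_map_stalkMap, htop, Ideal.map_top]
        exact eq_top_iff.mpr fun r _ => Submodule.mem_colon.mpr fun p _ => Submodule.mem_top
      · exact D.blowupInv hZ _ _ (by omega) han x' (stalkIdeal_radical_sup_eq' D (by omega) (by omega)).symm
    obtain ⟨rest, hwa, hco, hT, hexit⟩ := ih (a - M.mult) (by omega) hZ'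
      (M.transform (blowup.π ((M.ideal ⊔ Ex).radical)) ((M.ideal ⊔ Ex).radical))
      (((M.ideal ⊔ Ex).radical).comap (blowup.π ((M.ideal ⊔ Ex).radical)))
      (blowup.π ((M.ideal ⊔ Ex).radical) ⁻¹' T) hn hTE' hstep
    refine ⟨CentreSeq.cons _ rest,
      ⟨support_radical_sup_subset' hTE han (by omega) hinv', hSreg, hwa⟩,
      ⟨support_radical_sup_subset_T hTE, hco⟩, hT, fun x hx hord => ?_⟩
    have hx' : rest.comp x ∈ blowup.π ((M.ideal ⊔ Ex).radical) ⁻¹' T := hx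
    simpa [CentreSeq.transformMarked_cons] using
      hexit x hx' (by simpa [CentreSeq.transformMarked_cons] using hord)

end Stage

end Summit.ResolutionOfSingularities.ResolutionOfSingularities.Theorems.PinchTower
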